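import Summits.QuantumFields.BalabanUV.T4Continuum.Support.CTGaugeUnitFactorHbd
import Summits.QuantumFields.BalabanUV.T4Continuum.Support.CTConjDefectDischarge

/-!
# T⁴ programme, spine node NE2 (U1a), sub-row Δ3 «NE2-WALK» (T4-DAG `T4-U1a.S-NE2-D3-WALK°`) — THE GAUGE SLOT's CONJUGATED (H-bd) `hP₄`
# FROM THE (3.35)-CLASS, THE BACKGROUND FAMILY's UNIT DATUM AND NUMERIC SMALLNESS; ROOT B's DECAY STATIONS WITH `hdec` FULLY FED
# (file E3 = the END of «Δ3-CT-HBD-B4»)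

NE2 formalisation swarm `b2b-balaban-t4-ne2-formalise-*`, leaf prover 06 (gen 3), supplier item «Δ3-CT-HBD-B4» file E3 (E1 `CTCovariantScalarGreen`,
E2a `CTGaugeSandwichHbd`, E2b `CTGaugeUnitFactorHbd`; chain «Δ3-CT» p220700∕p220892, «Δ3-CT-HBD» p221704∕p221931, «Δ3-CT-HBD-B3» p223352∕p223438,
«Δ3-CT-HJ» `CTConjDefectDischarge`; owner ruling R21 (c)).  ROOT B's gauge slot is
`gaugeSlot Rg (QuT (siteT Rg)) Q1 a′ k = −(gaugeP Rg (QuT (siteT Rg)) a′ k − gaugeP 1 Q1 a′ k)` (`NE2BalabanGauge.gaugeSlot`,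
`GaugeTermPerturbationLaw.gaugeTerm`), each `gaugeP` a sandwich `D_R·G′Q′ᴴNQ′G′·D_Rᴴ` (`GaugeTermLayer.gaugeP`, `Sop_eq_scalarOp`):
 * §1 **`opNorm_conjMat_gaugeFamily_le`**: one family `(R, T)` at one level — `‖c(D_R·P·D_Rᴴ)‖ ≤ Bfam := (e^{|κ|}(1+τ)K₂)²·(σK − deltaKU)⁻¹` from the
   sizes `α` (`connS`), `τ` (`T − 1`), the unit datum `Coercive σK K` and the smallness `γ_U − Jcov > 0`, `deltaKU < σK` (E2a + E2b);
 * §2 the tower dictionary: **`gaugeP_eq_family`** (`gaugeP R (QuT T) a′ k` IS §1's sandwich at `n = n_k`), **`gaugeP_one_eq_family`** (the free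
   family is `(1, 1)`), **`coercive_gramK_one`** — the FREE unit datum is a THEOREM: `Coercive (σ₀²) K_{1,k}` (substrate's `CTGaugeTerm.coercive_Kcomp`,
   `GaugeTermScalarData.gram_one_eq`, `GaugeTermCoercivity.coercive_kron_one`);
 * §3 **`hP4_gaugeSlot_of_regular`**: at the canonical weights, from `hreg : RegularTransporters (liftR Rg) α β` (`d ≥ 1`; sizes `α` and
   `τ = e^{(d+1)α} − 1` via `RegularSiteTransporters.norm_siteT_sub_one_le`), the background family's unit datum
   `hKU : ∀ k, Coercive σU (K_U k)` (DISPLAYED — row B4's Neumann datum) and numeric smallness: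
   `∀ k y, ‖c(gaugeSlot k)·c((Δ_a^{(k)}⊗1)⁻¹)‖ ≤ kappa4CT := (Bfam_U + Bfam_1)·(γ_D − J)⁻¹`, `J = max (JA d a a″ κ 1) 0`;
 * §4 **`balaban_final_decayStations_of_regular_unitDatum`** — THE OWNER's ROOT-B DECAY STATIONS with `hdec` FED COMPLETELY by the chain:
   beyond the END of record's binders (`hreg`, `hNE3`, `a′`, `η`-threshold, `‖t‖ ≤ 1`) ONLY the background family's unit datum `hKU`, an auxiliary
   mass `a″`, and NUMERIC smallness of `(κ, t)` remain — no Combes–Thomas input, no kernel bound, no (1.126)-type hypothesis.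

HONEST FRAMING (T4-DAG p. 1).  Bookkeeping over landed modules ([folklore]); statements and constants OURS; MODEL level (transporters DATA, no B0);
`hKU` DISPLAYED here and DISCHARGED in file E4 `CTGaugeUnitDatum` (coercivity of the free datum perturbed by `‖K_U − K_1‖`); `hNE3` OPEN via the END of record; explicit admissible `κ` NOT computed; the two families' sandwiches are bounded SEPARATELY, so
`kappa4CT` does NOT vanish with the background (unlike row B4's un-conjugated `kappa4F`, which bounds the DIFFERENCE `gaugeP_U − gaugeP_1`):
the coupling condition `‖t‖·K < 1` is a genuine SMALL-COUPLING condition here and does not reach `t = 1` — the conjugated DIFFERENCE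
(telescoping `Z_UᴴN_UZ_U − Z_1ᴴN_1Z_1` under conjugation) is the follow-up that would; Δ3 NOT closed (the explicit rate; `hKU`; `t = 1`); NE2 (U1a) NOT PROVED; NE3 OPEN; spine PROVED 0/9 unchanged; NOT infinite volume, NOT a mass gap, NOT the Clay problem, NOT
summit progress.  HONEST DEPENDENCY: continuum YM on T⁴ ⇐ BetaPertH ∧ nine spine estimates (0/9 proved); BetaPertH ⇐ (D1) ∧ (D4) ∧ CAP+tail;
G-an2-4 gates asym, D1 and NE2/3/4.  ABSOLUTE RULE kept; no `sorry`.
-/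

noncomputable section

open scoped BigOperators ComplexConjugate Matrix Matrix.Norms.L2Operator Kronecker ComplexOrder

namespace Summit.QuantumFields.BalabanUV.T4Continuum.CTGaugeSlotHbd

open Literature.MathematicalPhysics.QuantumFieldTheory.Balaban1983to89.B5Prop11Plancherel (Cst Cst_nonneg Tor fine unitVec)
open Literature.MathematicalPhysics.QuantumFieldTheory.Balaban1983to89.B5G183RateUnitTower (lev lev_neZero)
open Literature.MathematicalPhysics.QuantumFieldTheory.Balaban1983to89.B5Blocks16 (blockOf)
open Literature.MathematicalPhysics.QuantumFieldTheory.Balaban1983to89.T4EtaRateMin (LocalRate)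
open Summit.QuantumFields.BalabanUV.T4Continuum
open Summit.QuantumFields.BalabanUV.T4Continuum.CoerciveInverseTower (Coercive)
open Summit.QuantumFields.BalabanUV.T4Continuum.BalabanAveragedTowerUnit (idx one_le_lev')
open Summit.QuantumFields.BalabanUV.T4Continuum.BackgroundResolventTower
open Summit.QuantumFields.BalabanUV.T4Continuum.KingPairingPlantedLaw (calDalev CJ)
open Summit.QuantumFields.BalabanUV.T4Continuum.KroneckerLift (kron_mul kron_inv kron_conjTranspose)
open Summit.QuantumFields.BalabanUV.T4Continuum.BlockMultiplication (siteMul siteMul_one)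
open Summit.QuantumFields.BalabanUV.T4Continuum.GramPerturbationLaw (C2gram)
open Summit.QuantumFields.BalabanUV.T4Continuum.NE2FromNE3 (bgReadings)
open Summit.QuantumFields.BalabanUV.T4Continuum.NE2ColourPerturbedLayer (pertCovC pertLimC)
open Summit.QuantumFields.BalabanUV.T4Continuum.RegularBackgroundTower (RegularTransporters regClass betaNE3)
open Summit.QuantumFields.BalabanUV.T4Continuum.GaugeTermDecomposition (covGrad sand)
open Summit.QuantumFields.BalabanUV.T4Continuum.GaugeTermSandwichBound (projP Nop)
open Summit.QuantumFields.BalabanUV.T4Continuum.GaugeTermLayer (Sop Gop gaugeP cl)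
open Summit.QuantumFields.BalabanUV.T4Continuum.GaugeTermPerturbationLaw (oneR gaugeTerm)
open Summit.QuantumFields.BalabanUV.T4Continuum.GaugeTermScalarData (QuT Q1 QuT_one Sop_eq_scalarOp gram_one_eq Bs_eq_Qiso_kron Gop_one_eq)
open Summit.QuantumFields.BalabanUV.T4Continuum.GaugeTermCoercivity (coercive_kron_one)
open Summit.QuantumFields.BalabanUV.T4Continuum.RegularSiteTransporters (siteT norm_siteT_sub_one_le)
open Summit.QuantumFields.BalabanUV.T4Continuum.NestedContourTransport (theta0)
open Summit.QuantumFields.BalabanUV.T4Continuum.NE2BalabanRoot (balabanPert)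
open Summit.QuantumFields.BalabanUV.T4Continuum.NE2BalabanGauge (gaugeSlot liftR)
open Summit.QuantumFields.BalabanUV.T4Continuum.NE2BalabanLayerSharp (kappaBs C2Bs)
open Summit.QuantumFields.BalabanUV.T4Continuum.NE2BalabanWiring (epsR CdeltaR)
open Summit.QuantumFields.BalabanUV.T4Continuum.NE2BalabanFinal (kappa4F C4F)
open Summit.QuantumFields.BalabanUV.T4Continuum.NE2BalabanThreshold (etaStar)
open Summit.QuantumFields.BalabanUV.T4Continuum.DecayRateInterpolation (EntryDecay DecayRate TwoLevelDecayRate)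
open Summit.QuantumFields.BalabanUV.T4Continuum.ScalarAveragedPropagator (DeltaPs Gps gammaPs)
open Summit.QuantumFields.BalabanUV.T4Continuum.ScalarAveragedCompression (Qiso Kcomp sigma0 Kcomp_eq_iso)
open Summit.QuantumFields.BalabanUV.T4Continuum.ScalarCovariantLaplacian (scalarOp connS Bs scalarOp_one)
open Summit.QuantumFields.BalabanUV.T4Continuum.ScalarCovariantCoercive (gammaU siteW Jcov)
open Summit.QuantumFields.BalabanUV.T4Continuum.CTWeightedCoercivity
open Summit.QuantumFields.BalabanUV.T4Continuum.CTScalarGreen (Jfree)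
open Summit.QuantumFields.BalabanUV.T4Continuum.CTGaugeTerm (deltaK coercive_Kcomp)
open Summit.QuantumFields.BalabanUV.T4Continuum.CTVectorPropagator (JA)
open Summit.QuantumFields.BalabanUV.T4Continuum.CTWeightedEnergy (K2 K2_nonneg)
open Summit.QuantumFields.BalabanUV.T4Continuum.CTAveragedTowerDecay (opNorm_conjMat_kron_inv_le_of_wCoercive)
open Summit.QuantumFields.BalabanUV.T4Continuum.CTConjugatedHbd (wCoercive_calDa_of_conjDefect conjMat_neg)
open Summit.QuantumFields.BalabanUV.T4Continuum.CTKingTowerWeights (rho rhoSite distKC abs_rhoSite_fineStep_le abs_rhoSite_sub_le_one_of_blockOf_eq)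
open Summit.QuantumFields.BalabanUV.T4Continuum.CTCovariantLaplacianDecay (kappaColCT)
open Summit.QuantumFields.BalabanUV.T4Continuum.CTAveragingSummandHbd (kappaAvgCT)
open Summit.QuantumFields.BalabanUV.T4Continuum.CTConjDefectDischarge (conjDefect_calDalev_rho max_JA_lt_gamD
  balaban_final_decayStations_of_regular_small)
open Summit.QuantumFields.BalabanUV.T4Continuum.CTCovariantScalarGreen (bondCW cR)
open Summit.QuantumFields.BalabanUV.T4Continuum.CTGaugeSandwichHbd
open Summit.QuantumFields.BalabanUV.T4Continuum.CTGaugeUnitFactorHbd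
open Summit.QuantumFields.BalabanUV.T4Continuum.DirichletRegionTower (gamD gamD_pos)

variable {d : ℕ}

/-! ## §1 One family at one level -/

section Family

variable (n : ℕ) [NeZero n] (M : Fin d → ℕ) [hM : ∀ μ, NeZero (M μ)]
variable {o : Type*} [Fintype o] [DecidableEq o]
variable {ρ₀ : Tor (fine n M) → ℝ} {κ a' : ℝ}
variable {R : Fin d → (Tor (fine n M) → Matrix o o ℂ)} {T : Tor (fine n M) → Matrix o o ℂ} {α τ σK : ℝ}

/-- the bound of one family's conjugated gauge sandwich: `Bfam = (e^{|κ|}(1+τ)K₂)·(σK − deltaKU)⁻¹·(e^{|κ|}(1+τ)K₂)`. [folklore] -/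
def Bfam (co d : ℕ) (a' α τ σK κ : ℝ) : ℝ :=
  (Real.exp |κ| * (1 + τ) * K2 (gammaU d a' α τ - Jcov co d a' α τ κ) (Jcov co d a' α τ κ) (cR d α κ))
    * (σK - deltaKU co d a' α τ κ)⁻¹
    * (Real.exp |κ| * (1 + τ) * K2 (gammaU d a' α τ - Jcov co d a' α τ κ) (Jcov co d a' α τ κ) (cR d α κ))

/-- **ONE FAMILY's CONJUGATED GAUGE SANDWICH** from sizes, the unit datum and smallness. [folklore] -/
theorem opNorm_conjMat_gaugeFamily_le (ha' : 0 < a') (hα : 0 ≤ α) (hτ : 0 ≤ τ)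
    (hR : ∀ μ x, ‖connS (fine n M) ((n : ℕ) : ℂ) R μ x‖ ≤ α) (hT : ∀ x, ‖T x - 1‖ ≤ τ)
    (hlip : ∀ x ν, |ρ₀ (x + unitVec (fine n M) ν) - ρ₀ x| ≤ 1 / n) (hosc : ∀ x x', blockOf n M x = blockOf n M x' → |ρ₀ x - ρ₀ x'| ≤ 1)
    (hγU : 0 < gammaU d a' α τ) (hγ : 0 < gammaU d a' α τ - Jcov (Fintype.card o) d a' α τ κ)
    (hK : Coercive σK ((Bs o n M * siteMul T) * (scalarOp n M a' R T)⁻¹ * (scalarOp n M a' R T)⁻¹ * (Bs o n M * siteMul T)ᴴ))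
    (hδ : deltaKU (Fintype.card o) d a' α τ κ < σK) :
    ‖conjMat κ (bondCW n M (o := o) ρ₀) (bondCW n M (o := o) ρ₀)
        (sand (fine n M) ((n : ℕ) : ℂ) R (projP (fine n M) (scalarOp n M a' R T)⁻¹ (Bs o n M * siteMul T)))‖
      ≤ Bfam (Fintype.card o) d a' α τ σK κ :=
  opNorm_conjMat_gaugeSandwich_le n M ha' hα hτ hR hT hlip hosc hγ (inv_nonneg.mpr (sub_pos.mpr hδ).le)
    (opNorm_conjMat_Nop_le n M ha' hα hτ hR hT hlip hosc hγU hγ hK hδ)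

end Family

/-! ## §2 The tower dictionary and the free unit datum -/

section Tower

variable (L : ℕ) [NeZero L] (M : Fin d → ℕ) [hM : ∀ μ, NeZero (M μ)]
variable {o : Type*} [Fintype o] [DecidableEq o]

/-- `gaugeP R (QuT T) a′ k` IS §1's sandwich at `n = n_k` (`Sop_eq_scalarOp`). [folklore] -/
theorem gaugeP_eq_family (R : (k : ℕ) → Fin d → (Tor (fine (lev L k) M) → Matrix o o ℂ))
    (T : (k : ℕ) → Tor (fine (lev L k) M) → Matrix o o ℂ) (a' : ℝ) (k : ℕ) :
    gaugeP L M R (QuT L M o T) a' k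
      = sand (fine (lev L k) M) ((lev L k : ℕ) : ℂ) (R k)
          (projP (fine (lev L k) M) (scalarOp (lev L k) M a' (R k) (T k))⁻¹ (Bs o (lev L k) M * siteMul (T k))) := by
  rw [gaugeP, Gop, Sop_eq_scalarOp]; rfl

/-- the free family is `(1, 1)`: `gaugeP 1 Q1 a′ k` is §1's sandwich at `R ≡ 1`, `T ≡ 1`. [folklore] -/
theorem gaugeP_one_eq_family (a' : ℝ) (k : ℕ) :
    gaugeP L M (oneR L M (o := o)) (Q1 L M o) a' k
      = sand (fine (lev L k) M) ((lev L k : ℕ) : ℂ) (fun _ _ => (1 : Matrix o o ℂ))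
          (projP (fine (lev L k) M) (scalarOp (lev L k) M a' (fun _ _ => (1 : Matrix o o ℂ)) (fun _ => (1 : Matrix o o ℂ)))⁻¹
            (Bs o (lev L k) M * siteMul (fun _ : Tor (fine (lev L k) M) => (1 : Matrix o o ℂ)))) := by
  rw [← QuT_one, gaugeP_eq_family]

/-- **THE FREE UNIT DATUM IS A THEOREM**: `Coercive (σ₀²) K_{1,k}` in §1's form (substrate's `coercive_Kcomp`, lifted). [folklore] -/
theorem coercive_gramK_one {a' : ℝ} (ha' : 0 < a') (n : ℕ) [NeZero n] :
    Coercive (sigma0 d a' ^ 2)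
      ((Bs o n M * siteMul (fun _ : Tor (fine n M) => (1 : Matrix o o ℂ))) * (scalarOp n M a' (fun _ _ => (1 : Matrix o o ℂ)) (fun _ => (1 : Matrix o o ℂ)))⁻¹
        * (scalarOp n M a' (fun _ _ => (1 : Matrix o o ℂ)) (fun _ => (1 : Matrix o o ℂ)))⁻¹ * (Bs o n M * siteMul (fun _ : Tor (fine n M) => (1 : Matrix o o ℂ)))ᴴ) := by
  rw [siteMul_one, Matrix.mul_one, scalarOp_one, kron_inv, Bs_eq_Qiso_kron, kron_conjTranspose, ← kron_mul, ← kron_mul, ← kron_mul,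
    ← Gps, ← (Kcomp_eq_iso n M).1]
  exact coercive_kron_one (coercive_Kcomp n M ha')

end Tower

/-! ## §3 The gauge slot's conjugated (H-bd) on the (3.35)-class -/

section Slot

variable (L : ℕ) [NeZero L] (M : Fin d → ℕ) [hM : ∀ μ, NeZero (M μ)] (a : ℝ) (ha : 0 < a)
variable {o : Type*} [Fintype o] [DecidableEq o]

/-- the gauge slot's conjugated Neumann constant: `kappa4CT = (Bfam_U + Bfam_1)·(γ_D − J)⁻¹` with `τ = e^{(d+1)α} − 1` for the background family
and `(α, τ, σK) = (0, 0, σ₀²)` for the free one. [folklore] -/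
def kappa4CT (co d : ℕ) (a a' α σU J κ : ℝ) : ℝ :=
  (Bfam co d a' α (Real.exp ((d + 1 : ℕ) * α) - 1) σU κ + Bfam co d a' 0 0 (sigma0 d a' ^ 2) κ) * (gamD d a - J)⁻¹

/-- **`hP₄` FOR BAŁABAN's GAUGE SLOT FROM `hreg`, THE BACKGROUND UNIT DATUM AND SMALLNESS**: at the canonical weights, for every level and base
point, `‖c(gaugeSlot k)·c((Δ_a^{(k)}⊗1)⁻¹)‖ ≤ kappa4CT`. [folklore] -/
theorem hP4_gaugeSlot_of_regular (hd : 1 ≤ d) {Rg : (k : ℕ) → Fin d → (Tor (fine (lev L k) M) → Matrix o o ℂ)} {α β : ℝ}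
    (hreg : RegularTransporters L M (liftR L M Rg) α β) {a' : ℝ} (ha' : 0 < a') {κ J σU : ℝ}
    (hJ : ∀ (k : ℕ) (y : idx L M 0), ConjDefect (calDalev L M a ha k) κ (rho L M k y) J) (hJγ : J < gamD d a)
    (hγU : 0 < gammaU d a' α (Real.exp ((d + 1 : ℕ) * α) - 1))
    (hγ : 0 < gammaU d a' α (Real.exp ((d + 1 : ℕ) * α) - 1) - Jcov (Fintype.card o) d a' α (Real.exp ((d + 1 : ℕ) * α) - 1) κ)
    (hKU : ∀ k, Coercive σU ((QuT L M o (siteT L M Rg) k) * (scalarOp (lev L k) M a' (Rg k) (siteT L M Rg k))⁻¹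
      * (scalarOp (lev L k) M a' (Rg k) (siteT L M Rg k))⁻¹ * (QuT L M o (siteT L M Rg) k)ᴴ))
    (hδU : deltaKU (Fintype.card o) d a' α (Real.exp ((d + 1 : ℕ) * α) - 1) κ < σU)
    (hγ1 : 0 < gammaU d a' 0 0 - Jcov (Fintype.card o) d a' 0 0 κ) (hδ1 : deltaKU (Fintype.card o) d a' 0 0 κ < sigma0 d a' ^ 2)
    (k : ℕ) (y : idx L M 0 × o) :
    ‖conjMat κ (fun p : idx L M k × o => rho L M k y.1 p.1) (fun p : idx L M k × o => rho L M k y.1 p.1)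
          (gaugeSlot L M Rg (QuT L M o (siteT L M Rg)) (Q1 L M o) a' k)
        * conjMat κ (fun p : idx L M k × o => rho L M k y.1 p.1) (fun p : idx L M k × o => rho L M k y.1 p.1)
          (calDalev L M a ha k ⊗ₖ (1 : Matrix o o ℂ))⁻¹‖
      ≤ kappa4CT (Fintype.card o) d a a' α σU J κ := by
  haveI := lev_neZero L k
  have hα : 0 ≤ α := hreg.nonneg.1
  set τ : ℝ := Real.exp ((d + 1 : ℕ) * α) - 1 with hτdef
  have hτ : 0 ≤ τ := sub_nonneg.mpr (Real.one_le_exp (by positivity))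
  -- sizes of the background family at level k
  have hR : ∀ μ x, ‖connS (fine (lev L k) M) ((lev L k : ℕ) : ℂ) (Rg k) μ x‖ ≤ α := fun μ x => hreg.size k μ (x, μ)
  have hT : ∀ x, ‖siteT L M Rg k x - 1‖ ≤ τ := fun x => norm_siteT_sub_one_le hd hreg k x
  -- the free family's sizes are zero
  have hR1 : ∀ μ x, ‖connS (fine (lev L k) M) ((lev L k : ℕ) : ℂ) (fun (_ : Fin d) (_ : Tor (fine (lev L k) M)) => (1 : Matrix o o ℂ)) μ x‖ ≤ 0 :=
    fun μ x => by simp [connS]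
  have hT1 : ∀ x : Tor (fine (lev L k) M), ‖(fun _ : Tor (fine (lev L k) M) => (1 : Matrix o o ℂ)) x - 1‖ ≤ 0 := fun x => by simp
  -- the canonical weight
  have hlip := fun x ν => abs_rhoSite_fineStep_le L M k y.1 x ν
  have hosc := fun x x' hx => abs_rhoSite_sub_le_one_of_blockOf_eq L M k y.1 x x' hx
  -- the two families
  have hU := opNorm_conjMat_gaugeFamily_le (lev L k) M (ρ₀ := rhoSite L M k y.1) (κ := κ) ha' hα hτ hR hT hlip hosc hγU hγ (hKU k) hδU
  have hγU1 : 0 < gammaU d a' 0 0 :=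
    lt_of_lt_of_le hγ1 (sub_le_self _ (ScalarCovariantCoercive.Jcov_nonneg _ _ ha'.le le_rfl κ))
  have h1 := opNorm_conjMat_gaugeFamily_le (lev L k) M (ρ₀ := rhoSite L M k y.1) (κ := κ) ha' le_rfl le_rfl hR1 hT1 hlip hosc hγU1 hγ1
    (coercive_gramK_one M ha' (lev L k)) hδ1
  -- the free propagator's conjugated bound
  have hW := wCoercive_calDa_of_conjDefect (lev L k) (one_le_lev' L k) M a ha (hJ k y.1)
  have hγA : 0 < gamD d a - J := sub_pos.mpr hJγ
  have hG := opNorm_conjMat_kron_inv_le_of_wCoercive (o := o) hW hγA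
  -- the slot is minus the difference of the two sandwiches
  have e : gaugeSlot L M Rg (QuT L M o (siteT L M Rg)) (Q1 L M o) a' k
      = -(sand (fine (lev L k) M) ((lev L k : ℕ) : ℂ) (Rg k)
            (projP (fine (lev L k) M) (scalarOp (lev L k) M a' (Rg k) (siteT L M Rg k))⁻¹ (Bs o (lev L k) M * siteMul (siteT L M Rg k)))
          - sand (fine (lev L k) M) ((lev L k : ℕ) : ℂ) (fun _ _ => (1 : Matrix o o ℂ))
            (projP (fine (lev L k) M) (scalarOp (lev L k) M a' (fun _ _ => (1 : Matrix o o ℂ)) (fun _ => (1 : Matrix o o ℂ)))⁻¹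
              (Bs o (lev L k) M * siteMul (fun _ : Tor (fine (lev L k) M) => (1 : Matrix o o ℂ))))) := by
    rw [gaugeSlot, gaugeTerm, gaugeP_eq_family, gaugeP_one_eq_family]
  rw [e, conjMat_neg, neg_mul, norm_neg, conjMat_sub, Matrix.sub_mul]
  have hB0 : 0 ≤ Bfam (Fintype.card o) d a' α τ σU κ := (norm_nonneg _).trans hU
  have hB1 : 0 ≤ Bfam (Fintype.card o) d a' 0 0 (sigma0 d a' ^ 2) κ := (norm_nonneg _).trans h1
  calc _ ≤ ‖_‖ + ‖_‖ := norm_sub_le _ _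
    _ ≤ Bfam (Fintype.card o) d a' α τ σU κ * (gamD d a - J)⁻¹ + Bfam (Fintype.card o) d a' 0 0 (sigma0 d a' ^ 2) κ * (gamD d a - J)⁻¹ :=
        add_le_add ((Matrix.l2_opNorm_mul _ _).trans (mul_le_mul hU hG (norm_nonneg _) hB0))
          ((Matrix.l2_opNorm_mul _ _).trans (mul_le_mul h1 hG (norm_nonneg _) hB1))
    _ = kappa4CT (Fintype.card o) d a a' α σU J κ := by rw [kappa4CT, hτdef, add_mul]

/-! ## §4 ROOT B's decay stations with `hdec` fed completely -/

/-- **ROOT B IN THE DECAY CURRENCY WITH THE DECAY BINDER FED BY THE WHOLE CHAIN** (`L ≥ 2`, `d ≥ 1`): the owner's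
`NE2BalabanDecayRate.balaban_final_decayStations_of_regular` — every binder of the END of record (`hreg`, `hNE3` BY NAME and OPEN, `a′ > 0`,
`α, β ≤ η ≤ η⋆`, `‖t‖ ≤ 1`) — with `hdec` supplied by «Δ3-CT» + «Δ3-CT-HBD» (row B2) + «Δ3-CT-HBD-B3» (row B3) + «Δ3-CT-HJ» (the substrate's
VEC-6) + THIS FILE (row B4's gauge slot): beyond the END of record ONLY the background family's unit datum `hKU : ∀ k, Coercive σU K_U,k`,
an auxiliary mass `a″ > 0`, and NUMERIC smallness of `(κ, t)` remain (`J = max (JA d a a″ κ 1) 0`, `κ₄ = kappa4CT …`).  Model level;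
CONDITIONAL on NE3 + the (3.35)-class + the threshold + `hKU`; NE2 (U1a) is NOT proved by this. [cite: King1986, Lemma 4.5 (4.38) p.674
(shape); Balaban1985BackgroundPropagators, Thm 3.4 p.400 (shape)] [folklore] -/
theorem balaban_final_decayStations_of_regular_unitDatum (hL : 2 ≤ L) (hd : 1 ≤ d)
    {Rg : (k : ℕ) → Fin d → (Tor (fine (lev L k) M) → Matrix o o ℂ)}
    {α β : ℝ} (hreg : RegularTransporters L M (liftR L M Rg) α β) {C : ℝ} (hC : 0 ≤ C)
    (hNE3 : LocalRate (bgReadings L M (regClass L M (liftR L M Rg))) C ((L : ℝ)⁻¹)) {a' : ℝ} (ha' : 0 < a')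
    {η : ℝ} (hαη : α ≤ η) (hβη : β ≤ η) (hη : η ≤ etaStar o d a a') {t : ℂ} (ht : ‖t‖ ≤ 1)
    {a'' κ : ℝ} (ha'' : 0 < a'') (hκ : 0 ≤ κ) (hγ' : Jfree d a'' κ 1 < gammaPs d a'') (hδ' : deltaK d a'' κ 1 < sigma0 d a'' ^ 2)
    (hJA : JA d a a'' κ 1 < gamD d a) {σU : ℝ}
    (hγU : 0 < gammaU d a' α (Real.exp ((d + 1 : ℕ) * α) - 1))
    (hγ : 0 < gammaU d a' α (Real.exp ((d + 1 : ℕ) * α) - 1) - Jcov (Fintype.card o) d a' α (Real.exp ((d + 1 : ℕ) * α) - 1) κ)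
    (hKU : ∀ k, Coercive σU ((QuT L M o (siteT L M Rg) k) * (scalarOp (lev L k) M a' (Rg k) (siteT L M Rg k))⁻¹
      * (scalarOp (lev L k) M a' (Rg k) (siteT L M Rg k))⁻¹ * (QuT L M o (siteT L M Rg) k)ᴴ))
    (hδU : deltaKU (Fintype.card o) d a' α (Real.exp ((d + 1 : ℕ) * α) - 1) κ < σU)
    (hγ1 : 0 < gammaU d a' 0 0 - Jcov (Fintype.card o) d a' 0 0 κ) (hδ1 : deltaKU (Fintype.card o) d a' 0 0 κ < sigma0 d a' ^ 2)
    (htK : ‖t‖ * (kappaColCT o d a α β (d * (α ^ 2 + 2 * β)) (max (JA d a a'' κ 1) 0) κ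
      + kappaAvgCT (Fintype.card o) d a α (max (JA d a a'' κ 1) 0) κ + kappa4CT (Fintype.card o) d a a' α σU (max (JA d a a'' κ 1) 0) κ) < 1) :
    EntryDecay (distKC L M o)
        (pertLimC L M a ha (balabanPert L M a (liftR L M Rg) (gaugeSlot L M Rg (QuT L M o (siteT L M Rg)) (Q1 L M o) a')) t)
        ((gamD d a - max (JA d a a'' κ 1) 0)⁻¹ * (1 - ‖t‖ * (kappaColCT o d a α β (d * (α ^ 2 + 2 * β)) (max (JA d a a'' κ 1) 0) κ
      + kappaAvgCT (Fintype.card o) d a α (max (JA d a a'' κ 1) 0) κ + kappa4CT (Fintype.card o) d a a' α σU (max (JA d a a'' κ 1) 0) κ))⁻¹ * Real.exp (κ * 2)) κ ∧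
      DecayRate (distKC L M o)
        (pertCovC L M a ha (balabanPert L M a (liftR L M Rg) (gaugeSlot L M Rg (QuT L M o (siteT L M Rg)) (Q1 L M o) a')) t)
        (pertLimC L M a ha (balabanPert L M a (liftR L M Rg) (gaugeSlot L M Rg (QuT L M o (siteT L M Rg)) (Q1 L M o) a')) t)
        (Real.sqrt (2 * ((gamD d a - max (JA d a a'' κ 1) 0)⁻¹ * (1 - ‖t‖ * (kappaColCT o d a α β (d * (α ^ 2 + 2 * β)) (max (JA d a a'' κ 1) 0) κ
      + kappaAvgCT (Fintype.card o) d a α (max (JA d a a'' κ 1) 0) κ + kappa4CT (Fintype.card o) d a a' α σU (max (JA d a a'' κ 1) 0) κ))⁻¹ * Real.exp (κ * 2)) *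
          (Cpert (kappaBs o d a α β (a * (epsR o d α * (2 + epsR o d α) * Cst d a)) (kappa4F d a a' α β)) (2 * d * Cst d a) (CJ d a)
              (C2Bs o d L a α β C
                (a * C2gram (Cst d a) 1 (epsR o d α) (2 * d * Cst d a) (CJ d a) (Cst d a) (CdeltaR o d a α (theta0 d α (betaNE3 o C))))
                (C4F o d L a a' α β C)) 0 t / (1 - (L : ℝ)⁻¹))))
        (κ / 2) (Real.sqrt ((L : ℝ)⁻¹)) ∧
      TwoLevelDecayRate (distKC L M o)
        (pertCovC L M a ha (balabanPert L M a (liftR L M Rg) (gaugeSlot L M Rg (QuT L M o (siteT L M Rg)) (Q1 L M o) a')) t)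
        (Real.sqrt (2 * ((gamD d a - max (JA d a a'' κ 1) 0)⁻¹ * (1 - ‖t‖ * (kappaColCT o d a α β (d * (α ^ 2 + 2 * β)) (max (JA d a a'' κ 1) 0) κ
      + kappaAvgCT (Fintype.card o) d a α (max (JA d a a'' κ 1) 0) κ + kappa4CT (Fintype.card o) d a a' α σU (max (JA d a a'' κ 1) 0) κ))⁻¹ * Real.exp (κ * 2)) * (2 *
          Cpert (kappaBs o d a α β (a * (epsR o d α * (2 + epsR o d α) * Cst d a)) (kappa4F d a a' α β)) (2 * d * Cst d a) (CJ d a)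
              (C2Bs o d L a α β C
                (a * C2gram (Cst d a) 1 (epsR o d α) (2 * d * Cst d a) (CJ d a) (Cst d a) (CdeltaR o d a α (theta0 d α (betaNE3 o C))))
                (C4F o d L a a' α β C)) 0 t / (1 - (L : ℝ)⁻¹))))
        (κ / 2) (Real.sqrt ((L : ℝ)⁻¹)) :=
  balaban_final_decayStations_of_regular_small L M a ha hL hd hreg hC hNE3 ha' hαη hβη hη ht ha'' hκ hγ' hδ' hJA
    (hP4_gaugeSlot_of_regular L M a ha hd hreg ha' (conjDefect_calDalev_rho L M a ha ha'' hγ' hδ') (max_JA_lt_gamD a hJA)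
      hγU hγ hKU hδU hγ1 hδ1) htK

end Slot

end Summit.QuantumFields.BalabanUV.T4Continuum.CTGaugeSlotHbd

end
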